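import Mathlib
import Summits.Ventures.PercRepro2.Defs
import Summits.Ventures.PercRepro2.Independence
import Summits.Ventures.PercRepro2.Harris
import Summits.Ventures.PercRepro2.Graph
import Summits.Ventures.PercRepro2.Exploration
import Summits.Ventures.PercRepro2.Events
import Summits.Ventures.PercRepro2.FourFunctions
import Summits.Ventures.PercRepro2.Induced
import Summits.Ventures.PercRepro2.Frontier
import Summits.Ventures.PercRepro2.ObsIndependence
import Summits.Ventures.PercRepro2.BHK
import Summits.Ventures.PercRepro2.BHKEvents
import Summits.Ventures.PercRepro2.VdBKahn
import Summits.Ventures.PercRepro2.BHKAvoid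
import Summits.Ventures.PercRepro2.OrderPreservation
import Summits.Ventures.PercRepro2.OrderPreservationQuant
import Summits.Ventures.PercRepro2.R2PrimeThreeReduction
import Summits.Ventures.PercRepro2.YBridge
import Summits.Ventures.PercRepro2.Yu1Functionals
import Summits.Ventures.PercRepro2.EdgeBHK
import Summits.Ventures.PercRepro2.N0
import Summits.Ventures.PercRepro2.HF2
import Summits.Ventures.PercRepro2.Yu2
import Summits.Ventures.PercRepro2.Yu1Events
import Summits.Ventures.PercRepro2.Yu1
import Summits.Ventures.PercRepro2.Y

/-!
# The tilted-HF2 principle (blind cell PercRepro2, typer-1; lead g7 ADDENDUM 17 (12)(b),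
INBOX 2026-08-23T00:32:32Z)

Heavy exploration `S = C(a₂)` on `R′ = {a₁, a₃ ∉ S}` (`avoidAll a₂ {a₁, a₃}`); `β_l(S) = P_{G∖S}(b ∈
C(a₁))` (`beta a₁ b`, decreasing, `= 0` on `{b ∈ S}`); `W = M₂ + Δ_T` and `PD` as in `YBridge`.

* `tower_Nl`: `P(b ∈ C₁, R′) = E[β_l(S); R′]` (= `N_l` of HF2);
* `hf2_W`: **HF2 in the `YBridge` vocabulary** — `N_l · P(PD) ≤ W · P(R′)` under the labelling;
* `bhk_tilt`: BHK 1.3 on `R′` for an increasing `f ≥ 0` against `β_l`;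
* **`tilted_hf2`**: for every non-negative increasing `f` of `S`,
  `E[f β_l; R′] · P(PD) ≤ W · E[f; R′]` under the labelling — i.e. `P(b ∈ C₁ | W′) ≤ W / P(PD)`
  for every `f`-tilt `W′` of `R′` (ADDENDUM 17 (12)(b), the `X = {a_l, a₃}` case; the `X = {a_l}`
  case needs `P(b ∈ C₁ | Q) ≤ W / P(PD)` and is not in this file).
-/

namespace Summit.Ventures.PercRepro2

open UnionCluster Yu1

namespace TiltedHF2

variable {V : Type*} {E : Type*} [Fintype E] [DecidableEq E] [Fintype V] [DecidableEq V]
  {R : Type*} [Field R] [LinearOrder R] [IsStrictOrderedRing R]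

omit [Fintype E] [DecidableEq E] [Fintype V] in
/-- `{b ∈ C₁} ∩ R′` as a two-cluster event of the heavy exploration. -/
lemma Nl_event_eq (ends : E → Sym2 V) (a₁ a₂ a₃ b : V) :
    clusterInEvent ends a₂ Set.univ ∩ clusterInEvent ends a₁ {W | b ∈ W} ∩
        avoidAll ends a₂ {a₁, a₃} =
      connEvent ends a₁ b ∩ avoidAll ends a₂ {a₁, a₃} := by
  ext ω
  simp [clusterInEvent]

omit [LinearOrder R] [IsStrictOrderedRing R] in
/-- Tower: `N_l = P(b ∈ C₁, R′) = E[β_l(S); R′]`. -/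
lemma tower_Nl (p : E → R) (ends : E → Sym2 V) (a₁ a₂ a₃ b : V) :
    prob p (connEvent ends a₁ b ∩ avoidAll ends a₂ {a₁, a₃}) =
      expect p (fun ω => beta p ends a₁ b (cluster ends ω a₂) *
        (avoidAll ends a₂ {a₁, a₃}).indicator 1 ω) := by
  rw [← Nl_event_eq, prob_clusterIn_inter_avoid_eq_expect p ends a₂ a₁ (X := {a₁, a₃})
    (Finset.mem_insert_self a₁ {a₃})]
  unfold beta
  simp only [Set.indicator_univ, Pi.one_apply, one_mul]

/-- **HF2 in the `YBridge` vocabulary**: `P(b ∈ C₁, R′) · P(PD) ≤ W · P(R′)` under the labelling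
`P(b ↔ a₁) ≤ P(b ↔ a₂)`, `W = M₂ + Δ_T`, `R′ = avoidAll a₂ {a₁, a₃}`. -/
theorem hf2_W (p : E → R) (hp : IsProbVec p) (ends : E → Sym2 V) {a₁ a₂ a₃ b : V}
    (hord : prob p (connEvent ends a₁ b) ≤ prob p (connEvent ends a₂ b)) :
    prob p (connEvent ends a₁ b ∩ avoidAll ends a₂ {a₁, a₃}) * prob p (PDEvent ends a₁ a₂ a₃) ≤
      (massM2 p ends a₁ a₂ a₃ b + deltaT p ends a₁ a₂ a₃ b) * prob p (avoidAll ends a₂ {a₁, a₃}) := by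
  have h := hf2 p hp ends a₂ a₁ a₃ b hord
  rw [hf2_avoidAll_pair]
  unfold massM2 deltaT TEvent
  rw [PDEvent_eq_raw]
  exact h

/-- BHK 1.3 on the heavy exploration: for an increasing `f ≥ 0` of `S = C(a₂)`,
`P(R′) · E[f β_l; R′] ≤ E[f; R′] · E[β_l; R′]`. -/
lemma bhk_tilt (p : E → R) (hp : IsProbVec p) (ends : E → Sym2 V) (a₁ a₂ a₃ b : V)
    {f : Set V → R} (hf : Monotone f) (hf0 : ∀ S, 0 ≤ f S) :
    prob p (avoidAll ends a₂ {a₁, a₃}) *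
        expect p (fun ω => f (cluster ends ω a₂) * beta p ends a₁ b (cluster ends ω a₂) *
          (avoidAll ends a₂ {a₁, a₃}).indicator 1 ω) ≤
      expect p (fun ω => f (cluster ends ω a₂) * (avoidAll ends a₂ {a₁, a₃}).indicator 1 ω) *
        expect p (fun ω => beta p ends a₁ b (cluster ends ω a₂) *
          (avoidAll ends a₂ {a₁, a₃}).indicator 1 ω) := by
  have h := bhk_induced p hp ends a₂ (F₁ := f) (F₂ := fun W => 1 - beta p ends a₁ b W) hf
    (fun W W' hW => sub_le_sub_left (beta_anti p hp ends a₁ b hW) 1) hf0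
    (fun W => sub_nonneg.2 (beta_le_one p hp ends a₁ b W))
    Finset.univ {a₁, a₃} {a₁, a₃} (Finset.subset_univ _) (Finset.subset_univ _)
  simp only [REvent_univ, Finset.inter_self, Finset.union_self, expect_clusterObs_univ,
    Pi.mul_apply] at h
  have e1 : expect p (fun ω => (1 - beta p ends a₁ b (cluster ends ω a₂)) *
      (avoidAll ends a₂ {a₁, a₃}).indicator 1 ω) =
      prob p (avoidAll ends a₂ {a₁, a₃}) - expect p (fun ω => beta p ends a₁ b (cluster ends ω a₂) *
        (avoidAll ends a₂ {a₁, a₃}).indicator 1 ω) := by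
    rw [prob_eq_expect_indicator, ← expect_sub]
    congr 1
    funext ω
    simp only [Pi.sub_apply]
    ring
  have e2 : expect p (fun ω => f (cluster ends ω a₂) *
      (1 - beta p ends a₁ b (cluster ends ω a₂)) * (avoidAll ends a₂ {a₁, a₃}).indicator 1 ω) =
      expect p (fun ω => f (cluster ends ω a₂) * (avoidAll ends a₂ {a₁, a₃}).indicator 1 ω) -
      expect p (fun ω => f (cluster ends ω a₂) * beta p ends a₁ b (cluster ends ω a₂) *
        (avoidAll ends a₂ {a₁, a₃}).indicator 1 ω) := by
    rw [← expect_sub]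
    congr 1
    funext ω
    simp only [Pi.sub_apply]
    ring
  rw [e1, e2] at h
  nlinarith [h]

/-- **The tilted-HF2 principle** (ADDENDUM 17 (12)(b), `X = {a_l, a₃}`): for every non-negative
increasing functional `f` of the heavy cluster `S = C(a₂)`, under the labelling,
`E[f β_l; R′] · P(PD) ≤ W · E[f; R′]`. -/
theorem tilted_hf2 (p : E → R) (hp : IsProbVec p) (ends : E → Sym2 V) {a₁ a₂ a₃ b : V}
    (hord : prob p (connEvent ends a₁ b) ≤ prob p (connEvent ends a₂ b))
    {f : Set V → R} (hf : Monotone f) (hf0 : ∀ S, 0 ≤ f S) :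
    expect p (fun ω => f (cluster ends ω a₂) * beta p ends a₁ b (cluster ends ω a₂) *
        (avoidAll ends a₂ {a₁, a₃}).indicator 1 ω) * prob p (PDEvent ends a₁ a₂ a₃) ≤
      (massM2 p ends a₁ a₂ a₃ b + deltaT p ends a₁ a₂ a₃ b) *
        expect p (fun ω => f (cluster ends ω a₂) * (avoidAll ends a₂ {a₁, a₃}).indicator 1 ω) := by
  have hB := bhk_tilt p hp ends a₁ a₂ a₃ b hf hf0
  have hH := hf2_W p hp ends (a₃ := a₃) hord
  rw [tower_Nl] at hH
  have hR0 := prob_nonneg hp (avoidAll ends a₂ {a₁, a₃})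
  have hD0 := prob_nonneg hp (PDEvent ends a₁ a₂ a₃)
  have hf0' : 0 ≤ expect p (fun ω => f (cluster ends ω a₂) *
      (avoidAll ends a₂ {a₁, a₃}).indicator 1 ω) :=
    expect_nonneg hp fun ω => mul_nonneg (hf0 _) (Set.indicator_nonneg (fun _ _ => zero_le_one) ω)
  rcases hR0.lt_or_eq with hR | hR
  · -- multiply the two inequalities and cancel `P(R′) > 0`
    have key : expect p (fun ω => f (cluster ends ω a₂) * beta p ends a₁ b (cluster ends ω a₂) *
        (avoidAll ends a₂ {a₁, a₃}).indicator 1 ω) * prob p (PDEvent ends a₁ a₂ a₃) *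
        prob p (avoidAll ends a₂ {a₁, a₃}) ≤
        (massM2 p ends a₁ a₂ a₃ b + deltaT p ends a₁ a₂ a₃ b) *
          expect p (fun ω => f (cluster ends ω a₂) * (avoidAll ends a₂ {a₁, a₃}).indicator 1 ω) *
          prob p (avoidAll ends a₂ {a₁, a₃}) := by
      calc expect p (fun ω => f (cluster ends ω a₂) * beta p ends a₁ b (cluster ends ω a₂) *
            (avoidAll ends a₂ {a₁, a₃}).indicator 1 ω) * prob p (PDEvent ends a₁ a₂ a₃) *
            prob p (avoidAll ends a₂ {a₁, a₃})
          = (prob p (avoidAll ends a₂ {a₁, a₃}) * expect p (fun ω => f (cluster ends ω a₂) *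
              beta p ends a₁ b (cluster ends ω a₂) * (avoidAll ends a₂ {a₁, a₃}).indicator 1 ω)) *
              prob p (PDEvent ends a₁ a₂ a₃) := by ring
        _ ≤ (expect p (fun ω => f (cluster ends ω a₂) * (avoidAll ends a₂ {a₁, a₃}).indicator 1 ω) *
              expect p (fun ω => beta p ends a₁ b (cluster ends ω a₂) *
                (avoidAll ends a₂ {a₁, a₃}).indicator 1 ω)) * prob p (PDEvent ends a₁ a₂ a₃) :=
            mul_le_mul_of_nonneg_right hB hD0
        _ = expect p (fun ω => f (cluster ends ω a₂) * (avoidAll ends a₂ {a₁, a₃}).indicator 1 ω) *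
              (expect p (fun ω => beta p ends a₁ b (cluster ends ω a₂) *
                (avoidAll ends a₂ {a₁, a₃}).indicator 1 ω) * prob p (PDEvent ends a₁ a₂ a₃)) := by
            ring
        _ ≤ expect p (fun ω => f (cluster ends ω a₂) * (avoidAll ends a₂ {a₁, a₃}).indicator 1 ω) *
              ((massM2 p ends a₁ a₂ a₃ b + deltaT p ends a₁ a₂ a₃ b) *
                prob p (avoidAll ends a₂ {a₁, a₃})) :=
            mul_le_mul_of_nonneg_left hH hf0'
        _ = _ := by ring
    exact le_of_mul_le_mul_right key hR
  · -- `P(R′) = 0`: both sides vanish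
    have h1 := expect_mul_indicator_eq_zero_of_null hp hR.symm
      (fun ω => f (cluster ends ω a₂) * beta p ends a₁ b (cluster ends ω a₂))
    have h2 := expect_mul_indicator_eq_zero_of_null hp hR.symm (fun ω => f (cluster ends ω a₂))
    rw [h1, h2, zero_mul, mul_zero]

end TiltedHF2

end Summit.Ventures.PercRepro2
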